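import Summits.Schanuel.Schanuel.Theorems.DiophantineDichotomyApproximationPropertyHighSatelliteLemmas
import Summits.Schanuel.Schanuel.Theorems.DiophantineDichotomyApproximationPropertyBoxModIdeal
import Summits.Schanuel.Schanuel.Theorems.DiophantineDichotomyApproximationPropertySmallPrimeHypersurface
import Summits.Schanuel.Schanuel.Theorems.DiophantineDichotomyApproximationPropertyCycleAPIAt3GlueLemmas
import Summits.Schanuel.Schanuel.Theorems.DiophantineDichotomyApproximationPropertyZeroDimDictionary
import Literature.NumberTheory.Transcendental.NesterenkoEliminationProp411Holds
import Literature.NumberTheory.Transcendental.PhilipponCriterionProjDist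
import Literature.RingTheory.MvPolynomial.HomogeneousDimension
import HarnessLib

/-!
# Stub `highSatellite3_of` of line `orbit-interpolation-determinant` (crux `ApproximationProperty`, stmt-Schanuel-6117) — the HIGH-SATELLITE lever

Route `DiophantineDichotomy` (sub-problem `Schanuel/Schanuel`), crux
`Summit.Schanuel.Schanuel.Theses.DiophantineDichotomy.ApproximationProperty` (stmt-Schanuel-6117), line
`orbit-interpolation-determinant`, skeleton v24 (lead `prover-line-stmt-Schanuel-6117-c12-0`), registered stub
`highSatellite3_of` — the ASSEMBLY of the new top-range lever: from the three registered support stubs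
(`pointDatum_of_closeZero`, `ideg_le_mul_of_rankTwo`, `exists_primeFactor_mem`, taken here as HYPOTHESES with their
registered signatures verbatim) it proves the far-satellite kernel of the `t = 3` transfer for satellites of degree
`deg 𝔮' ≥ ηΔ²`, for EVERY `η > 0` and every envelope constant `C₄ ≥ c₁`.

## The argument (KERNEL-c12.md)

Data: the clause-free descent at `(Δ, 8Y)` with constant `c₁` (`CycleAP3Datum`): `(Q)` prime of degree `a ≤ Δ`,
`P ∉ (Q)` of degree `b ≤ 2Δ`, the orbit `𝔭` (prime, rank `1`, `D = deg 𝔭 ≤ (c₁Δ)³`, `h(𝔭) ≤ 8c₁YΔ²`,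
`log |𝔭(1:ω)| ≤ −(Δh(𝔭) + 8YD)/c₁`); a satellite `𝔮'` (prime, rank `2`, `𝔮' ⊇ (Q, P)`, `𝔮' ≤ 𝔭`) ENVELOPING the
orbit at level `⌊C₄Δ⌋` (`ℚ[x̲]_{⌊C₄Δ⌋} ∩ 𝔭 ⊆ 𝔮'`), of degree `deg 𝔮' ≥ ηΔ²`.
1. `κ = min(1/(64c₁), η/4)`, `d₁ = ⌊κΔ⌋`, `N = ⌊e^{Y/c₁}⌋`. Dirichlet (`boxPrinciple`) gives `F ≠ 0` of degree `d₁`,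
   `h(F) ≤ log N ≤ Y/c₁`, `|F(1:ω)| ≤ exp(c_B(d₁+1) − ((binom(d₁+3,3) − 4)/2)·log(N+1))`.
2. ENVELOPE TRANSPORT (`mem_of_envelope`): a form of degree `μ ≤ ⌊C₄Δ⌋` in `𝔭` lies in `𝔮'` (multiply by a power of
   a variable outside `𝔮'`). Hence `F ∉ 𝔮' ⇒ F ∉ 𝔭`.
3. If `F ∈ 𝔮'`: an irreducible factor `Q₂ ∈ 𝔮'` of degree `1 ≤ a₂ ≤ d₁` (`exists_primeFactor_mem`). BÉZOUT
   (`ideg_le_mul_of_rankTwo`) twice: `deg 𝔮' ≤ 2Δ·a₂` (with `(Q, Q₂)` if `Q₂ ∉ (Q)`; else `a ≤ a₂` and `deg 𝔮' ≤ ab`),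
   so `a₂ ≥ ηΔ/2`; and the box principle MODULO `Q₂` in degree `2d₁` (`boxPrinciple_modIdeal` over
   `≥ a₂·binom(2d₁−a₂+3, 2)` standard monomials, `hilbert_span_singleton_eq`) gives `P₂ ∉ (Q₂)` with `P₂ ∉ 𝔮'`
   (else `deg 𝔮' ≤ 2a₂d₁ ≤ 2κ²Δ² < ηΔ²`), hence `P₂ ∉ 𝔭` by step 2.
4. Either way some form `g ∉ 𝔭` of degree `≤ 2κΔ ≤ Δ/(32c₁)`, height `≤ Y/c₁`, has
   `‖g‖_(1:ω) ≤ exp(c_B(2κΔ+1) − (r₀Δ³ − 2)·Y/c₁)`, `r₀ = min(κ³/96, ηκ²/32)`. Nesterenko's Prop. 4.11, case `r = 1`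
   (PROVED: `NesterenkoPhilippon2001_ch3_prop_4_11_holds`): `1 ≤ δ·exp(h(g)D + h(𝔭) deg g + 99 D deg g)`; the orbit's
   smallness makes the exponent `< (Δh(𝔭) + 8YD)/c₁`, so `δ ≠ |𝔭(1:ω)|`, i.e. `ρ((1:ω), V(𝔭)) < ‖g‖_(1:ω)
   ≤ exp(−(Δh(𝔭) + YD)/(2M₀))`, `M₀ = 2c₁(8c₁ + c₁³)/r₀` — the CLOSEST CONJUGATE carries the datum's accuracy, and
   `pointDatum_of_closeZero` (chart + dictionary + budgets) returns the `PointAPAbsAt 3`-datum at `(Δ, Y)`.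

Proofs only: no definitions, nothing asserted beyond the registered stub and its (private-namespace) helpers.
Sources: Nesterenko, LNM 1752 (2001) Ch. 3 §4 Prop. 4.11 (pp. 40–41); Philippon, Publ. Math. IHÉS 64 (1986) §3;
Nesterenko–Philippon (eds.), LNM 1752 Ch. 4 §4 p. 61 (AP2).
-/

set_option linter.dupNamespace false

noncomputable section

attribute [local instance] MvPolynomial.gradedAlgebra

namespace Summit.Schanuel.Schanuel.Cruxes.ApproximationProperty.OrbitInterpolationDeterminant

open Literature.NumberTheory.Transcendental Literature.NumberTheory.Transcendental.Nesterenko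
  Literature.NumberTheory.Transcendental.PhilipponMain MvPolynomial Real
open scoped BigOperators Nat

namespace HighSatellite

/-- **Degree of the satellite against a form of `𝔮'` through `(Q)`**: with Bézout for rank-2 primes (hypothesis
`hbez`, the registered stub `ideg_le_mul_of_rankTwo`), a satellite `𝔮' ∋ Q, P` of the c.i. `(Q, P)` (`deg Q = a ≤ Δ`,
`deg P = b ≤ 2Δ`) containing a non-zero form `Q₂` of degree `a₂ ≥ 1` generating a prime ideal has `deg 𝔮' ≤ 2Δ·a₂`:
if `Q₂ ∉ (Q)` Bézout for `(Q, Q₂)` gives `deg 𝔮' ≤ a·a₂`; if `Q₂ ∈ (Q)` then `a ≤ a₂` (degrees of forms) and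
`deg 𝔮' ≤ ab`. [folklore] -/
theorem ideg_le_of_factor
    (hbez : ∀ (Q P : Rx 3) (a b : ℕ), Q ≠ 0 → Q.IsHomogeneous a → P.IsHomogeneous b → 1 ≤ a → 1 ≤ b →
      (Ideal.span {Q}).IsPrime → P ∉ Ideal.span {Q} → ∀ 𝔮' : Ideal (Rx 3), 𝔮'.IsPrime →
      𝔮'.IsHomogeneous (homogeneousSubmodule (Fin (3 + 1)) ℚ) → IsUnmixedOfRank 𝔮' 2 → Q ∈ 𝔮' → P ∈ 𝔮' →
      ideg 𝔮' 2 ≤ a * b)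
    {Q P Q₂ : Rx 3} {a b a₂ : ℕ} {Δ : ℝ} (hQ0 : Q ≠ 0) (hQ : Q.IsHomogeneous a) (hP : P.IsHomogeneous b)
    (ha : 1 ≤ a) (hb : 1 ≤ b) (haΔ : (a : ℝ) ≤ Δ) (hbΔ : (b : ℝ) ≤ 2 * Δ) (hprime : (Ideal.span {Q}).IsPrime)
    (hPQ : P ∉ Ideal.span {Q}) (hQ₂0 : Q₂ ≠ 0) (hQ₂ : Q₂.IsHomogeneous a₂) (ha₂ : 1 ≤ a₂)
    {𝔮' : Ideal (Rx 3)} (h𝔮'p : 𝔮'.IsPrime) (h𝔮'h : 𝔮'.IsHomogeneous (homogeneousSubmodule (Fin (3 + 1)) ℚ))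
    (h𝔮'u : IsUnmixedOfRank 𝔮' 2) (hQ𝔮' : Q ∈ 𝔮') (hP𝔮' : P ∈ 𝔮') (hQ₂𝔮' : Q₂ ∈ 𝔮') :
    (ideg 𝔮' 2 : ℝ) ≤ 2 * Δ * a₂ := by
  have hΔ0 : 0 ≤ Δ := le_trans (by positivity) haΔ
  by_cases hmem : Q₂ ∈ Ideal.span {Q}
  · -- `Q ∣ Q₂`: degrees add, so `a ≤ a₂`, and `deg 𝔮' ≤ ab ≤ 2Δ a ≤ 2Δ a₂`
    obtain ⟨R, hR⟩ := Ideal.mem_span_singleton.mp hmem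
    have hR0 : R ≠ 0 := fun h => hQ₂0 (by rw [hR, h, mul_zero])
    have hRhom : R.IsHomogeneous R.totalDegree :=
      Roy2013.isHomogeneous_of_dvd hQ₂ hQ₂0 ⟨Q, by rw [hR, mul_comm]⟩
    have hprod : Q₂.IsHomogeneous (a + R.totalDegree) := by rw [hR]; exact hQ.mul hRhom
    have haa₂ : a ≤ a₂ := by
      have := IsHomogeneous.inj_right hQ₂ hprod hQ₂0
      omega
    have h1 : ideg 𝔮' 2 ≤ a * b := hbez Q P a b hQ0 hQ hP ha hb hprime hPQ 𝔮' h𝔮'p h𝔮'h h𝔮'u hQ𝔮' hP𝔮'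
    have h1' : (ideg 𝔮' 2 : ℝ) ≤ a * b := by exact_mod_cast h1
    have haa₂' : (a : ℝ) ≤ a₂ := by exact_mod_cast haa₂
    calc (ideg 𝔮' 2 : ℝ) ≤ a * b := h1'
      _ ≤ a * (2 * Δ) := mul_le_mul_of_nonneg_left hbΔ (by positivity)
      _ = 2 * Δ * a := by ring
      _ ≤ 2 * Δ * a₂ := mul_le_mul_of_nonneg_left haa₂' (by positivity)
  · have h1 : ideg 𝔮' 2 ≤ a * a₂ := hbez Q Q₂ a a₂ hQ0 hQ hQ₂ ha ha₂ hprime hmem 𝔮' h𝔮'p h𝔮'h h𝔮'u hQ𝔮' hQ₂𝔮'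
    have h1' : (ideg 𝔮' 2 : ℝ) ≤ a * a₂ := by exact_mod_cast h1
    calc (ideg 𝔮' 2 : ℝ) ≤ a * a₂ := h1'
      _ ≤ Δ * a₂ := mul_le_mul_of_nonneg_right haΔ (by positivity)
      _ ≤ 2 * Δ * a₂ := by nlinarith [show (0 : ℝ) ≤ Δ * a₂ by positivity]

end HighSatellite

open HighSatellite in
/-- **Registered stub `highSatellite3_of`** (crux `stmt-Schanuel-6117`, line `orbit-interpolation-determinant`,
skeleton v24): from the three registered support stubs `pointDatum_of_closeZero`, `ideg_le_mul_of_rankTwo`,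
`exists_primeFactor_mem` (hypotheses, verbatim), the far-satellite kernel of the `t = 3` transfer on satellites of
degree `deg 𝔮' ≥ ηΔ²` — for every `ω ∈ ℂ³`, `c₁ ≥ 1`, `C₄ ≥ c₁`, `η > 0` there are `λ = 8` and `c ≥ c₁` such that at
every scale `Y ≥ Δ ≥ c`, a datum of the clause-free descent at `(Δ, λY)` whose orbit lies on a satellite `𝔮'`
(rank-2 prime minimal over `(Q, P)`, `𝔮' ≤ 𝔭`) enveloping it at level `⌊C₄Δ⌋`, of degree `≥ ηΔ²`, yields a
`PointAPAbsAt 3`-datum at `(Δ, Y)`. Proof: module docstring (two-form Bézout non-membership, envelope transport,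
Nesterenko's Prop. 4.11 with `r = 1`, closest conjugate, packaging).
[cite: NesterenkoPhilippon2001, Ch. 3 Prop. 4.11 (pp. 40–41); Ch. 4 §4 (p. 61)] -/
theorem highSatellite3_of : (∀ t : ℕ, 1 ≤ t → ZeroDimDictionary → ∀ (ω : Fin t → ℂ) (c₁ lam M : ℝ), 1 ≤ c₁ → 1 ≤ lam → 0 < M → ∃ c : ℝ, c₁ ≤ c ∧ ∀ Δ Y : ℝ, c ≤ Δ → Δ ≤ Y → ∀ 𝔭 : Ideal (Rx t), 𝔭.IsPrime → 𝔭.IsHomogeneous (homogeneousSubmodule (Fin (t + 1)) ℚ) → IsUnmixedOfRank 𝔭 1 → (ideg 𝔭 1 : ℝ) ≤ (c₁ * Δ) ^ t → iheight 𝔭 1 ≤ c₁ * (lam * Y) * Δ ^ (t - 1) → ∀ z ∈ projZeros 𝔭, projDist (Fin.cons 1 ω) z ≤ Real.exp (-((Δ * iheight 𝔭 1 + Y * ideg 𝔭 1) / (2 * M))) → ∃ (K : Type) (_ : Field K) (_ : NumberField K) (β : Fin t → K) (σ : K →+* ℂ), (Module.finrank ℚ K : ℝ) ≤ (c * Δ)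 ^ t ∧ Height.logHeight (Fin.cons (1 : K) β : Fin (t + 1) → K) ≤ c * Y * Δ ^ (t - 1) ∧ ‖(fun j => σ (β j)) - ω‖ ≤ Real.exp (-((Δ * Height.logHeight (Fin.cons (1 : K) β : Fin (t + 1) → K) + Y * Module.finrank ℚ K) / c))) → (∀ (Q P : Rx 3) (a b : ℕ), Q ≠ 0 → Q.IsHomogeneous a → P.IsHomogeneous b → 1 ≤ a → 1 ≤ b → (Ideal.span {Q}).IsPrime → P ∉ Ideal.span {Q} → ∀ 𝔮' : Ideal (Rx 3), 𝔮'.IsPrime → 𝔮'.IsHomogeneous (homogeneousSubmodule (Fin (3 + 1)) ℚ) → IsUnmixedOfRank 𝔮' 2 → Q ∈ 𝔮' → P ∈ 𝔮' → ideg 𝔮' 2 ≤ a * b) → (∀ (F : Rx 3) (d : ℕ) (𝔮' : Ideal (Rx 3)), F ≠ 0 → F.IsHomogeneous d → 𝔮'.IsPrime → F ∈ 𝔮' → ∃ (Q₂ : Rx 3) (a₂ : ℕ), Q₂ ≠ 0 ∧ Q₂.IsHomogeneous a₂ ∧ 1 ≤ a₂ ∧ a₂ ≤ d ∧ (Ideal.span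 {Q₂}).IsPrime ∧ Q₂ ∣ F ∧ Q₂ ∈ 𝔮') → ∀ (ω : Fin 3 → ℂ) (c₁ : ℝ), 1 ≤ c₁ → ∀ C₄ : ℝ, c₁ ≤ C₄ → ∀ η : ℝ, 0 < η → ∃ lam : ℝ, 1 ≤ lam ∧ ∃ c : ℝ, c₁ ≤ c ∧ ∀ Δ Y : ℝ, c ≤ Δ → Δ ≤ Y → ∀ (Q : Rx 3) (a : ℕ) (P : Rx 3) (b : ℕ) (𝔮 : Ideal (Rx 3)) (T : Rx 3) (τ : ℕ) (𝔭 𝔮' : Ideal (Rx 3)), CycleAP3Datum ω c₁ Δ (lam * Y) Q a P b 𝔮 T τ 𝔭 → 𝔮'.IsPrime → 𝔮'.IsHomogeneous (homogeneousSubmodule (Fin (3 + 1)) ℚ) → IsUnmixedOfRank 𝔮' 2 → 𝔮' ∈ (Ideal.span {Q} ⊔ Ideal.span {P}).minimalPrimes → 𝔮' ≤ 𝔭 → homogeneousSubmodule (Fin (3 + 1)) ℚ ⌊C₄ * Δ⌋₊ ⊓ 𝔭.restrictScalars ℚ ≤ 𝔮'.restrictScalars ℚ → η * Δ ^ 2 ≤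 (ideg 𝔮' 2 : ℝ) → ∃ (K : Type) (_ : Field K) (_ : NumberField K) (β : Fin 3 → K) (σ : K →+* ℂ), (Module.finrank ℚ K : ℝ) ≤ (c * Δ) ^ 3 ∧ Height.logHeight (Fin.cons (1 : K) β : Fin (3 + 1) → K) ≤ c * Y * Δ ^ 2 ∧ ‖(fun j => σ (β j)) - ω‖ ≤ Real.exp (-((Δ * Height.logHeight (Fin.cons (1 : K) β : Fin (3 + 1) → K) + Y * Module.finrank ℚ K) / c)) := by
  intro hclose hbez hfac ω c₁ hc₁ C₄ hC₄ η hη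
  classical
  have hc₁0 : 0 < c₁ := by linarith
  -- constants at `ω`
  obtain ⟨cB₁, hcB₁, hbox₁⟩ := boxPrinciple 3 ω
  obtain ⟨cB₂, hcB₂, hbox₂⟩ := boxPrinciple_modIdeal 3 ω
  obtain ⟨cB, hcBdef⟩ : ∃ cB : ℝ, cB = max cB₁ cB₂ := ⟨_, rfl⟩
  have hcB₁le : cB₁ ≤ cB := hcBdef ▸ le_max_left _ _
  have hcB₂le : cB₂ ≤ cB := hcBdef ▸ le_max_right _ _
  have hcB : 0 < cB := lt_of_lt_of_le hcB₁ hcB₁le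
  obtain ⟨κ, hκdef⟩ : ∃ κ : ℝ, κ = min (1 / (64 * c₁)) (η / 4) := ⟨_, rfl⟩
  have hκ0 : 0 < κ := hκdef ▸ lt_min (by positivity) (by positivity)
  have hκ64 : κ ≤ 1 / (64 * c₁) := hκdef ▸ min_le_left _ _
  have hκη : κ ≤ η / 4 := hκdef ▸ min_le_right _ _
  have hκ64' : κ ≤ 1 / 64 := hκ64.trans (by
    rw [div_le_div_iff₀ (by positivity) (by positivity)]; linarith)
  have hκ1 : κ ≤ 1 := hκ64'.trans (by norm_num)
  obtain ⟨r₀, hr₀def⟩ : ∃ r₀ : ℝ, r₀ = min (κ ^ 3 / 96) (η * κ ^ 2 / 32) := ⟨_, rfl⟩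
  have hr₀0 : 0 < r₀ := hr₀def ▸ lt_min (by positivity) (by positivity)
  have hr₀A : r₀ ≤ κ ^ 3 / 96 := hr₀def ▸ min_le_left _ _
  have hr₀B : r₀ ≤ η * κ ^ 2 / 32 := hr₀def ▸ min_le_right _ _
  obtain ⟨M₀, hM₀def⟩ : ∃ M₀ : ℝ, M₀ = 2 * c₁ * (8 * c₁ + c₁ ^ 3) / r₀ := ⟨_, rfl⟩
  have hM₀ : 0 < M₀ := hM₀def ▸ by positivity
  -- the packaging constant (boost `λ = 8`)
  obtain ⟨cP, hcP, hpack⟩ := hclose 3 (by norm_num) stub_zeroDimDictionary ω c₁ 8 M₀ hc₁ (by norm_num) hM₀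
  -- the constant of the stub
  obtain ⟨c, hcdef⟩ : ∃ c : ℝ, c = cP + ((8 + 6 * c₁ * cB) / r₀ + 1) + 2 / κ := ⟨_, rfl⟩
  have hpos1 : 0 ≤ (8 + 6 * c₁ * cB) / r₀ + 1 := by positivity
  have hpos2 : 0 ≤ 2 / κ := by positivity
  have hcPc : cP ≤ c := by rw [hcdef]; linarith
  have hcP0 : 0 < cP := by linarith
  refine ⟨8, by norm_num, c, hcP.trans hcPc, ?_⟩
  intro Δ Y hΔ hY Q a P b 𝔮 T τ 𝔭 𝔮' hdat h𝔮'p h𝔮'h h𝔮'u h𝔮'min hle henv hηΔ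
  -- unpack the datum
  obtain ⟨hQ0, hQhom, ha1, haΔ, hQprime, hPhom, hb1, hbΔ, hPQ, -, -, -, -, -, -, -, -, -, -, -, -,
    h𝔭p, h𝔭h, h𝔭u, -, -, -, hD, hh, habs⟩ := hdat
  have hQ𝔮' : Q ∈ 𝔮' := h𝔮'min.1.2 (Ideal.mem_sup_left (Ideal.subset_span (Set.mem_singleton Q)))
  have hP𝔮' : P ∈ 𝔮' := h𝔮'min.1.2 (Ideal.mem_sup_right (Ideal.subset_span (Set.mem_singleton P)))
  -- scales
  have hcPΔ : cP ≤ Δ := hcPc.trans hΔ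
  have hΔ₁ : (8 + 6 * c₁ * cB) / r₀ + 1 ≤ Δ := by rw [hcdef] at hΔ; linarith
  have hκΔ2 : 2 ≤ κ * Δ := by
    have h2 : 2 / κ ≤ Δ := by rw [hcdef] at hΔ; linarith
    rw [div_le_iff₀ hκ0] at h2
    linarith [mul_comm Δ κ]
  have hΔ1 : 1 ≤ Δ := by linarith
  have hΔ0 : 0 < Δ := by linarith
  have hY0 : 0 < Y := by linarith
  have hD1 : (1 : ℝ) ≤ ideg 𝔭 1 := by
    exact_mod_cast Literature.Barriers.Schanuel.one_le_ideg_of_isPrime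
      NesterenkoPhilippon2001_ch3_prop_4_4_holds le_rfl (by norm_num) h𝔭p h𝔭h h𝔭u
  have hh0 : 0 ≤ iheight 𝔭 1 := height_nonneg _
  -- the auxiliary degree `d₁ = ⌊κΔ⌋`
  obtain ⟨d₁, hd₁def⟩ : ∃ d₁ : ℕ, d₁ = ⌊κ * Δ⌋₊ := ⟨_, rfl⟩
  have hd₁le : (d₁ : ℝ) ≤ κ * Δ := hd₁def ▸ Nat.floor_le (by positivity)
  have hd₁ge : κ * Δ / 2 ≤ d₁ := by
    have := Nat.lt_floor_add_one (κ * Δ)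
    rw [← hd₁def] at this
    linarith
  have hd₁pos : 1 ≤ d₁ := by
    have : (1 : ℝ) ≤ d₁ := by linarith
    exact_mod_cast this
  have h2d₁ : 2 * (d₁ : ℝ) ≤ Δ / (32 * c₁) := by
    calc 2 * (d₁ : ℝ) ≤ 2 * (κ * Δ) := by linarith
      _ ≤ 2 * (1 / (64 * c₁) * Δ) := by gcongr
      _ = Δ / (32 * c₁) := by field_simp; ring
  have h2d₁' : 2 * (d₁ : ℝ) ≤ Δ := h2d₁.trans (div_le_self hΔ0.le (by linarith))
  -- the height scale `N = ⌊e^{Y/c₁}⌋`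
  obtain ⟨N, hNdef⟩ : ∃ N : ℕ, N = ⌊Real.exp (Y / c₁)⌋₊ := ⟨_, rfl⟩
  have hN1 : 1 ≤ N := hNdef ▸ Nat.le_floor (by exact_mod_cast Real.one_le_exp (by positivity : 0 ≤ Y / c₁))
  have hNpos : (0 : ℝ) < N := by exact_mod_cast hN1
  have hlogN : Real.log N ≤ Y / c₁ := by
    calc Real.log N ≤ Real.log (Real.exp (Y / c₁)) :=
          Real.log_le_log hNpos (hNdef ▸ Nat.floor_le (Real.exp_pos _).le)
      _ = Y / c₁ := Real.log_exp _
  have hlogN1 : Y / c₁ ≤ Real.log ((N : ℝ) + 1) := by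
    rw [Real.le_log_iff_exp_le (by positivity)]
    exact (hNdef ▸ Nat.lt_floor_add_one (Real.exp (Y / c₁))).le
  have hL0 : 0 ≤ Real.log ((N : ℝ) + 1) := Real.log_nonneg (by linarith)
  -- a variable outside the satellite
  obtain ⟨i, hi⟩ : ∃ i, (X i : Rx 3) ∉ 𝔮' := by
    haveI := h𝔮'p
    refine Literature.RingTheory.MvPolynomial.exists_X_notMem_of_ringKrullDim_ne_zero ?_
    rw [SatelliteRestartGlue.rank_eq_two h𝔮'p h𝔮'u]
    exact_mod_cast (by norm_num : (2 : ℕ) ≠ 0)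
  -- the auxiliary degrees sit below the envelope level
  have hlev : 2 * d₁ ≤ ⌊C₄ * Δ⌋₊ := by
    refine Nat.le_floor ?_
    push_cast
    exact h2d₁'.trans (le_mul_of_one_le_left hΔ0.le (hc₁.trans hC₄))
  -- KEY CLAIM: a small auxiliary form missing the orbit
  obtain ⟨g, dg, hg𝔭, hghom, hdg1, hdgle, hgh, hg1, hgsmall⟩ :
      ∃ (g : Rx 3) (dg : ℕ), g ∉ 𝔭 ∧ g.IsHomogeneous dg ∧ 1 ≤ dg ∧ (dg : ℝ) ≤ 2 * d₁ ∧
        height g ≤ Y / c₁ ∧ 1 ≤ maxNorm g ∧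
        ‖aeval (Fin.cons 1 ω : Fin (3 + 1) → ℂ) g‖ ≤
          Real.exp (cB * (2 * κ * Δ + 1) - (r₀ * Δ ^ 3 - 2) * Real.log ((N : ℝ) + 1)) := by
    -- Step 1: Dirichlet in degree `d₁`
    have h4 : 4 ≤ (d₁ + 3).choose d₁ := by
      rw [Nat.choose_symm_add]
      calc 4 = (1 + 3).choose 3 := by decide
        _ ≤ (d₁ + 3).choose 3 := Nat.choose_le_choose 3 (by omega)
    obtain ⟨F, hF0, hFhom, hF1, -, hFh, hFsmall⟩ := hbox₁ d₁ N ((d₁ + 3).choose d₁) hN1 h4 le_rfl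
    have hFh' : height F ≤ Y / c₁ := hFh.trans hlogN
    by_cases hF𝔮' : F ∈ 𝔮'
    · -- Case B: `F ∈ 𝔮'`; an irreducible factor `Q₂ ∈ 𝔮'`, and the box principle modulo `Q₂`
      obtain ⟨Q₂, a₂, hQ₂0, hQ₂hom, ha₂1, ha₂d, hQ₂prime, -, hQ₂𝔮'⟩ := hfac F d₁ 𝔮' hF0 hFhom h𝔮'p hF𝔮'
      have hdeg𝔮' : (ideg 𝔮' 2 : ℝ) ≤ 2 * Δ * a₂ :=
        ideg_le_of_factor hbez hQ0 hQhom hPhom ha1 hb1 haΔ hbΔ hQprime hPQ hQ₂0 hQ₂hom ha₂1 h𝔮'p h𝔮'h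
          h𝔮'u hQ𝔮' hP𝔮' hQ₂𝔮'
      have ha₂ : η * Δ / 2 ≤ a₂ := by
        have h1 : η * Δ ^ 2 ≤ 2 * Δ * a₂ := hηΔ.trans hdeg𝔮'
        have h2 : η * Δ / 2 * Δ ≤ (a₂ : ℝ) * Δ := by
          rw [show η * Δ / 2 * Δ = (η * Δ ^ 2) / 2 by ring, show (a₂ : ℝ) * Δ = (2 * Δ * a₂) / 2 by ring]
          linarith
        exact le_of_mul_le_mul_right h2 hΔ0
      obtain ⟨b₂, hb₂def⟩ : ∃ b₂ : ℕ, b₂ = 2 * d₁ := ⟨_, rfl⟩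
      have hab₂ : a₂ ≤ b₂ := by omega
      have hb₂1 : 1 ≤ b₂ := by omega
      have hdb : d₁ ≤ b₂ - a₂ := by omega
      have hdb' : 4 ≤ b₂ - a₂ + 3 := by omega
      have hb₂' : (b₂ : ℝ) = 2 * d₁ := by rw [hb₂def]; push_cast; ring
      obtain ⟨M₂, hM₂def⟩ : ∃ M₂ : ℕ, M₂ = a₂ * (b₂ - a₂ + 3).choose 2 := ⟨_, rfl⟩
      have hM₂4 : 4 ≤ M₂ := by
        have h1 : (1 + 3).choose 2 ≤ (b₂ - a₂ + 3).choose 2 := Nat.choose_le_choose 2 hdb'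
        have h2 : (1 + 3).choose 2 = 6 := by decide
        rw [hM₂def]
        calc 4 ≤ 1 * 6 := by norm_num
          _ ≤ a₂ * (b₂ - a₂ + 3).choose 2 := Nat.mul_le_mul ha₂1 (h2 ▸ h1)
      have hsq : (a₂ : ℝ) * (d₁ : ℝ) ^ 2 ≤ 2 * (M₂ : ℝ) := by
        have h1 : d₁ ^ 2 ≤ 2 * (b₂ - a₂ + 3).choose 2 := sq_le_two_mul_choose hdb
        have h2 : a₂ * d₁ ^ 2 ≤ 2 * M₂ := by
          calc a₂ * d₁ ^ 2 ≤ a₂ * (2 * (b₂ - a₂ + 3).choose 2) := Nat.mul_le_mul_left _ h1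
            _ = 2 * M₂ := by rw [hM₂def]; ring
        exact_mod_cast h2
      have hcount := hilbert_count hQ₂hom hQ₂0 hab₂
      rw [← hM₂def] at hcount
      obtain ⟨P₂, hP₂Q₂, hP₂hom, hP₂1, -, hP₂h, hP₂small⟩ :=
        hbox₂ (Ideal.span {Q₂}) b₂ N M₂ (HilbertTruncation.forall_mem_span_singleton hQ₂hom) hN1 hM₂4 hcount
      clear hcount
      -- `P₂ ∉ 𝔮'` by Bézout for `(Q₂, P₂)`
      have hκ2 : 2 * (κ * Δ) ^ 2 < η * Δ ^ 2 := by
        have hk2 : κ ^ 2 ≤ 1 / 64 * (η / 4) := by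
          rw [sq]; exact mul_le_mul hκ64' hκη hκ0.le (by norm_num)
        have e1 : 2 * (κ * Δ) ^ 2 = 2 * κ ^ 2 * Δ ^ 2 := by ring
        have e2 : 2 * κ ^ 2 * Δ ^ 2 ≤ 2 * (1 / 64 * (η / 4)) * Δ ^ 2 :=
          mul_le_mul_of_nonneg_right (by linarith) (by positivity)
        have e3 : 2 * (1 / 64 * (η / 4)) * Δ ^ 2 = η * Δ ^ 2 / 128 := by ring
        have e4 : 0 < η * Δ ^ 2 := by positivity
        linarith
      have hP₂𝔮' : P₂ ∉ 𝔮' := by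
        intro hmem
        have h1 : ideg 𝔮' 2 ≤ a₂ * b₂ := hbez Q₂ P₂ a₂ b₂ hQ₂0 hQ₂hom hP₂hom ha₂1 hb₂1 hQ₂prime hP₂Q₂ 𝔮'
          h𝔮'p h𝔮'h h𝔮'u hQ₂𝔮' hmem
        have h2 : (ideg 𝔮' 2 : ℝ) ≤ a₂ * b₂ := by exact_mod_cast h1
        have ha₂d' : (a₂ : ℝ) ≤ d₁ := by exact_mod_cast ha₂d
        have h3 : (a₂ : ℝ) * b₂ ≤ 2 * (κ * Δ) ^ 2 := by
          rw [hb₂']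
          have e : (a₂ : ℝ) * (2 * d₁) ≤ (κ * Δ) * (2 * (κ * Δ)) :=
            mul_le_mul (ha₂d'.trans hd₁le) (by linarith) (by positivity) (by positivity)
          have e' : (κ * Δ) * (2 * (κ * Δ)) = 2 * (κ * Δ) ^ 2 := by ring
          linarith
        linarith
      have hP₂𝔭 : P₂ ∉ 𝔭 := fun hmem => hP₂𝔮' (mem_of_envelope h𝔮'p hi henv hP₂hom (hb₂def ▸ hlev) hmem)
      refine ⟨P₂, b₂, hP₂𝔭, hP₂hom, hb₂1, hb₂'.le, hP₂h.trans hlogN, hP₂1, hP₂small.trans ?_⟩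
      rw [Real.exp_le_exp]
      have hrate : r₀ * Δ ^ 3 - 2 ≤ ((M₂ : ℝ) - 4) / 2 := rateB hsq ha₂ hd₁ge hη.le hκ0.le hΔ0.le hr₀B
      have e1 : cB₂ * ((b₂ : ℝ) + 1) ≤ cB * (2 * κ * Δ + 1) :=
        mul_le_mul hcB₂le (by rw [hb₂']; linarith) (by positivity) hcB.le
      have e2 := mul_le_mul_of_nonneg_right hrate hL0
      linarith
    · -- Case A: `F ∉ 𝔮'`, hence `F ∉ 𝔭` by the envelope
      have hF𝔭 : F ∉ 𝔭 := fun hmem =>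
        hF𝔮' (mem_of_envelope h𝔮'p hi henv hFhom (le_trans (Nat.le_mul_of_pos_left d₁ two_pos) hlev) hmem)
      refine ⟨F, d₁, hF𝔭, hFhom, hd₁pos, le_mul_of_one_le_left (Nat.cast_nonneg _) one_le_two, hFh', hF1,
        hFsmall.trans ?_⟩
      rw [Real.exp_le_exp]
      have hC : ((d₁ : ℝ) + 1) ^ 3 ≤ 6 * (((d₁ + 3).choose d₁ : ℕ) : ℝ) := by
        have h' : (d₁ + 1) ^ 3 ≤ 3 ! * (d₁ + 3).choose d₁ :=
          SmallPrimeHypersurface.succ_pow_le_factorial_mul_choose d₁ 3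
        have h'' : (d₁ + 1) ^ 3 ≤ 6 * (d₁ + 3).choose d₁ := by simpa [Nat.factorial] using h'
        exact_mod_cast h''
      have hrate : r₀ * Δ ^ 3 - 2 ≤ ((((d₁ + 3).choose d₁ : ℕ) : ℝ) - 4) / 2 :=
        rateA hC hd₁ge hκ0.le hΔ0.le hr₀A
      have e1 : cB₁ * ((d₁ : ℝ) + 1) ≤ cB * (2 * κ * Δ + 1) :=
        mul_le_mul hcB₁le (by linarith) (by positivity) hcB.le
      have e2 := mul_le_mul_of_nonneg_right hrate hL0
      linarith
  -- Nesterenko's Prop. 4.11 with `r = 1`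
  have hω₁0 : (Fin.cons 1 ω : Fin (3 + 1) → ℂ) ≠ 0 := fun h0 => by
    have := congr_fun h0 0
    simp at this
  have h411 := (NesterenkoPhilippon2001_ch3_prop_4_11_holds 3 1 𝔭 g dg le_rfl (by norm_num) h𝔭p h𝔭h h𝔭u
    hghom hdg1 hg𝔭).2 rfl (Fin.cons 1 ω) hω₁0
  obtain ⟨E, hEdef⟩ : ∃ E : ℝ,
      E = height g * ideg 𝔭 1 + iheight 𝔭 1 * dg + 11 * ((3 : ℕ) : ℝ) ^ 2 * ideg 𝔭 1 * dg := ⟨_, rfl⟩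
  rw [← hEdef] at h411
  have hdgΔ : (dg : ℝ) ≤ Δ / (32 * c₁) := hdgle.trans h2d₁
  have hElt : -((Δ * iheight 𝔭 1 + 8 * Y * ideg 𝔭 1) / c₁) + E < 0 := by
    rw [hEdef]
    push_cast
    exact liouville_exponent_lt hc₁ hΔ0 hY hD1 hh0 hdgΔ hgh
  have hsmall𝔭 : iabs 𝔭 1 (Fin.cons 1 ω) * Real.exp E < 1 := by
    calc iabs 𝔭 1 (Fin.cons 1 ω) * Real.exp E
        ≤ Real.exp (-((Δ * iheight 𝔭 1 + 8 * Y * ideg 𝔭 1) / c₁)) * Real.exp E :=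
          mul_le_mul_of_nonneg_right habs (Real.exp_pos _).le
      _ = Real.exp (-((Δ * iheight 𝔭 1 + 8 * Y * ideg 𝔭 1) / c₁) + E) := by rw [← Real.exp_add]
      _ < 1 := Real.exp_lt_one_iff.mpr hElt
  have hρlt : rho (Fin.cons 1 ω) 𝔭 < normAt (Fin.cons 1 ω) g := by
    by_contra hcon
    rw [bezoutDelta_of_le (not_lt.mp hcon)] at h411
    have : (1 : ℝ) < 1 := lt_of_le_of_lt h411 hsmall𝔭
    exact lt_irrefl _ this
  -- the auxiliary form is that small
  have hX : Δ * iheight 𝔭 1 + Y * ideg 𝔭 1 ≤ (8 * c₁ + c₁ ^ 3) * Y * Δ ^ 3 := by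
    have e1 : Δ * iheight 𝔭 1 ≤ Δ * (c₁ * (8 * Y) * Δ ^ 2) := mul_le_mul_of_nonneg_left hh hΔ0.le
    have e2 : Y * ideg 𝔭 1 ≤ Y * (c₁ * Δ) ^ 3 := mul_le_mul_of_nonneg_left hD hY0.le
    have e3 : Δ * (c₁ * (8 * Y) * Δ ^ 2) + Y * (c₁ * Δ) ^ 3 = (8 * c₁ + c₁ ^ 3) * Y * Δ ^ 3 := by ring
    linarith
  have hnorm : normAt (Fin.cons 1 ω) g ≤ Real.exp (-((Δ * iheight 𝔭 1 + Y * ideg 𝔭 1) / (2 * M₀))) := by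
    have h1 : normAt (Fin.cons 1 ω) g ≤ ‖aeval (Fin.cons 1 ω : Fin (3 + 1) → ℂ) g‖ := by
      unfold normAt
      exact div_le_self (norm_nonneg _)
        (one_le_mul_of_one_le_of_one_le hg1 (one_le_pow₀ (one_le_norm_cons_one ω)))
    have h2 := smallness_le (κ := κ) (L := Real.log ((N : ℝ) + 1)) hr₀0 hcB hκ1 hc₁ hΔ₁ hY hlogN1 hX
    rw [← hM₀def] at h2
    exact h1.trans (hgsmall.trans (Real.exp_le_exp.mpr h2))
  -- some conjugate is within that distance
  have hne : (projDist (Fin.cons 1 ω : Fin (3 + 1) → ℂ) '' projZeros 𝔭).Nonempty := by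
    obtain ⟨cd, -, hdict⟩ := stub_zeroDimDictionary 3 (by norm_num)
    obtain ⟨K, _i1, _i2, bK, hb0, hzeros, -⟩ := hdict 𝔭 h𝔭p h𝔭h h𝔭u
    obtain ⟨σ₀⟩ := (inferInstance : Nonempty (K →+* ℂ))
    have hz0 : (fun j => σ₀ (bK j)) ≠ 0 := by
      intro h0
      apply hb0
      funext j
      have := congr_fun h0 j
      simpa using this
    have hz : (fun j => σ₀ (bK j)) ∈ projZeros 𝔭 := (hzeros _).mpr ⟨hz0, σ₀, 1, by simp⟩
    exact ⟨_, _, hz, rfl⟩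
  obtain ⟨_, ⟨z, hz, rfl⟩, hzlt⟩ := exists_lt_of_csInf_lt hne hρlt
  have hzle : projDist (Fin.cons 1 ω) z ≤ Real.exp (-((Δ * iheight 𝔭 1 + Y * ideg 𝔭 1) / (2 * M₀))) :=
    (hzlt.trans_le hnorm).le
  -- packaging
  have hh' : iheight 𝔭 1 ≤ c₁ * (8 * Y) * Δ ^ (3 - 1) := by rw [show (3 : ℕ) - 1 = 2 from rfl]; exact hh
  obtain ⟨K, iF, iN, β, σ, hd, hhK, hacc⟩ := hpack Δ Y hcPΔ hY 𝔭 h𝔭p h𝔭h h𝔭u hD hh' z hz hzle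
  refine ⟨K, iF, iN, β, σ, ?_, ?_, ?_⟩
  · exact hd.trans (pow_le_pow_left₀ (by positivity) (mul_le_mul_of_nonneg_right hcPc hΔ0.le) 3)
  · have hhK' : Height.logHeight (Fin.cons (1 : K) β : Fin (3 + 1) → K) ≤ cP * Y * Δ ^ 2 := by
      rw [show (3 : ℕ) - 1 = 2 from rfl] at hhK; exact hhK
    exact hhK'.trans (mul_le_mul_of_nonneg_right (mul_le_mul_of_nonneg_right hcPc hY0.le) (sq_nonneg _))
  · refine hacc.trans ?_
    rw [Real.exp_le_exp, neg_le_neg_iff]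
    exact div_le_div_of_nonneg_left (by positivity) hcP0 hcPc

end Summit.Schanuel.Schanuel.Cruxes.ApproximationProperty.OrbitInterpolationDeterminant

end
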